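import Summits.QuantumFields.YangMills.Theorems.BalabanUVNodesK0VariationalThm1C1Floor
import Literature.MathematicalPhysics.QuantumFieldTheory.Balaban1983to89.Node00.Record12BgRowCoClassGauge

/-!
# K0⁶ ROW P11 — UNIFORM-FLUX ABELIAN CONFIGURATIONS on Bałaban's torus: plaquettes, vanishing co-divergence, straight-line transports and the holonomy `D^{s²}`
# around an `s × s` square (kinematic half of the FLUX FLOOR `L·M ≲ B₉` of dag-n07-e's gauge-fixing sentence `Gauge152OfClassTopStep`)

Cell `pub-ymgap`, seat `pub-ymgap-dag-n21-c` g10 (R134 (a) N21 NE7c s1; K0 ROW P11 negative lane of record for the [15]-fact editions).  Filed `--kind proof --supports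
stmt-QuantumFields-20506 --as helper` (K0⁶ `Record13SepCoPRInhabited`).  [15] = [Balaban1985Variational], [6] = [Balaban1985RegularSpaces], [I] = [Balaban1987RG1].

THE CONFIGURATION (displayed by the hypothesis `hU : ∀ b, U b = if b.dir = μ₂ then D ^ (b.src μ₁).val else 1`, no `def`): the bond variable on `⟨x, e_{μ₂}⟩` is `D^{x_{μ₁}}`
(`x_{μ₁} ∈ {0, …, P−1}` the canonical representative, `P = sitesPerDir 0`), `1` on every other bond, with `D ∈ SU(N)` of order dividing the period (`hDP : D ^ P = 1`, so the
field is consistent across the seam `x_{μ₁} = P − 1 → 0`) and `μ₁ < μ₂`.  It is the lattice Landau-gauge potential of a CONSTANT abelian field strength: every plaquette in the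
`μ₁μ₂`-plane is `D`, every other plaquette is `1` — dag-n07-e's «uniform flux» engine (INBOX l.19990, ERRATUM l.≈20060).

WHAT THIS FILE PROVES (theorems only; any `N ≥ 1`, any torus `P`, level `0`).
* `pow_val_add_one` — `D^{(a+1).val} = D^{a.val}·D` under `D^P = 1` (the seam bookkeeping; Mathlib `pow_eq_pow_mod`).
* ★ `plaqHol_flux` — `U(∂p) = D` if `(p.μ, p.ν) = (μ₁, μ₂)`, else `1`; `dist1_plaqHol_flux_le` (`≤ dist1 D`).
* ★ `coDivSum_flux` — the lattice Yang–Mills current [6] (1.2) of the configuration VANISHES at every bond (`Sect2.coDivSum U x μ = 0`): the plaquette matrix is translation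
  invariant and commutes with every bond variable (all are powers of `D`), so each term `R(U(x,x−e_ν))F(x−e_ν) − F(x)` of (1.2) is `0`; hence `coDivSmallOn_flux` at every
  positive threshold.  (The crude bound `‖coDiv‖ ≤ 2d·max dist1(∂U)` of FILE 21A would cost a factor `η_k` in the floor; the exact vanishing does not.)
* straight transports: `holAt_flux_replicate_dir₁` (`= 1` along `±e_{μ₁}`), `holAt_flux_replicate_fwd₂` (`= D^{n·x_{μ₁}}` along `(+e_{μ₂})^n` from `x`),
  `holAt_flux_replicate_bwd₂` (`= (D^{n·x_{μ₁}})⁻¹` along `(−e_{μ₂})^n`).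
* ★ `holAt_flux_rectWord` — ABELIAN STOKES for the square: along `T4ReflectionCone.rectWord μ₁ μ₂ s s = (+e₁)^s(+e₂)^s(−e₁)^s(−e₂)^s` from a site with `x_{μ₁} = 0` and
  `s < P`, the holonomy is `D^{s·s}` (the flux through the square).
* generic walk bookkeeping (any gauge group): `dist1_holAt_le_length_mul` (`dist1 𝒰(γ) ≤ |γ|·c` if every bond variable met is within `c` of `1`; `dist1_mul_le`, `dist1_inv`),
  `mem_walk_replicate_true` ∕ `mem_walk_replicate_false` (the bonds of a straight segment from `π(z)` are `⟨π(z ± i e_μ), μ⟩`), `unshift_cover`.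
Companion `…K0Gauge152FluxFloor` feeds these to `Gauge152OfClassTopStep` at the TOP index: the handed-over gauge on a non-wrapping `L^{k+1}M`-cube conjugates the square
holonomy `D^{s²}` by `u(x₀)` and bounds it by `4s·2η_kB₉ε`, whence `L·M ≲ B₉`.

HONEST FRAMING: lattice kinematics ([folklore] algebra on the tree's own objects); nothing of Bałaban asserted or refuted; K0⁶ neither discharged nor refuted; N21 NOT
discharged; counts unmoved (typed 28∕28 · discharged 5∕28); one finite `𝕋⁴` torus family at fixed `ε = L^{−K}`; not continuum ∕ OS ∕ mass gap ∕ Clay.  THEOREMS ONLY: no `def`,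
`instance`, `notation`, `sorry`; standard axioms.
DEPENDENCES (by name): `GaugeField.plaqHol`, `Site.shift ∕ unshift`, node00-def-P11 FILE 9 `Sect2.coDivSum ∕ coDivTerm ∕ plaqMat ∕ CoDivSmallOn` (`Record12BgRowCoDiv`), NODE 00 `ιSU ∕ coe_ιSU`,
`T4Continuum.walk ∕ holAt ∕ walkEnd ∕ holAt_cons ∕ holAt_nil ∕ walkEnd_apply`, `BlockAveraging`'s `walk_append ∕ holAt_append ∕ walkEnd_append`, `T4ReflectionCone.rectWord ∕ netDisp_replicate`,
this lineage's FILE 12 `shift_cover`, `B15Eq112TorusCover.cover`.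
-/

noncomputable section

open scoped Matrix.Norms.L2Operator

namespace Summit.QuantumFields.YangMills.Theorems.K0UniformFluxConfig

open Literature.MathematicalPhysics.QuantumFieldTheory.Balaban1983to89
open Literature.MathematicalPhysics.QuantumFieldTheory.Balaban1983to89.Node00
open Literature.MathematicalPhysics.QuantumFieldTheory.Balaban1983to89.T4Continuum
open B15Eq112TorusCover B14DomainGeom B12RegularSpaces111
open Summit.QuantumFields.YangMills.Theorems.K0BgProvisoOverRange (shift_cover)

/-! ## §1  Generic walk bookkeeping (any gauge group, any torus, any level) -/
section Walks

variable {P : Params} {j : ℕ} {G : Type*} [GaugeGroup G]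

/-- `dist1 𝒰(γ) ≤ |γ|·c` when every bond variable met along `γ` is within `c` of `1` (`dist1 (gh) ≤ dist1 g + dist1 h`, `dist1 g⁻¹ = dist1 g`). [folklore] -/
theorem dist1_holAt_le_length_mul (V : GaugeField P j G) {c : ℝ} :
    ∀ γ : List (LStep P j), (∀ st ∈ γ, dist1 (V st.bond) ≤ c) → dist1 (holAt V γ) ≤ γ.length * c
  | [], _ => by simp [holAt_nil, GaugeGroup.dist1_one]
  | st :: γ, h => by
      rw [holAt_cons, List.length_cons]
      have h1 : dist1 (if st.fwd then V st.bond else (V st.bond)⁻¹) ≤ c := by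
        split_ifs
        · exact h st (by simp)
        · rw [GaugeGroup.dist1_inv]; exact h st (by simp)
      have h2 := dist1_holAt_le_length_mul V γ fun st' hst' => h st' (List.mem_cons_of_mem _ hst')
      calc dist1 ((if st.fwd then V st.bond else (V st.bond)⁻¹) * holAt V γ)
          ≤ dist1 (if st.fwd then V st.bond else (V st.bond)⁻¹) + dist1 (holAt V γ) := GaugeGroup.dist1_mul_le _ _
        _ ≤ c + γ.length * c := add_le_add h1 h2
        _ = ((γ.length + 1 : ℕ) : ℝ) * c := by push_cast; ring

/-- `π(z) − e_μ = π(z − e_μ)` on the torus. [cite: Balaban1987RG1, (0.1) p.251 (bookkeeping)] -/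
theorem unshift_cover (z : Pt P.d) (μ : Fin P.d) : (cover P z).unshift μ = cover P (Function.update z μ (z μ - 1)) := by
  funext i
  by_cases h : i = μ
  · subst h; simp [Site.unshift, cover]
  · simp [Site.unshift, cover, Function.update_of_ne h]

/-- The bonds of the forward straight segment `(+e_μ)^n` from `π(z)` are `⟨π(z + i e_μ), μ⟩`, `i < n`. [folklore] -/
theorem mem_walk_replicate_true (μ : Fin P.d) :
    ∀ (n : ℕ) (z : Pt P.d), ∀ st ∈ walk (cover P z) (List.replicate n (μ, true)),
      ∃ i : ℕ, i < n ∧ st.bond = ⟨cover P (Function.update z μ (z μ + i)), μ⟩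
  | 0, z, st, hst => by simp [walk] at hst
  | n + 1, z, st, hst => by
      rw [List.replicate_succ] at hst
      change st ∈ (⟨⟨cover P z, μ⟩, true⟩ :: walk ((cover P z).shift μ) (List.replicate n (μ, true))) at hst
      rcases List.mem_cons.1 hst with rfl | hst'
      · exact ⟨0, Nat.succ_pos _, by simp⟩
      · rw [shift_cover] at hst'
        obtain ⟨i, hi, hb⟩ := mem_walk_replicate_true μ n _ st hst'
        refine ⟨i + 1, by omega, ?_⟩
        rw [hb]
        congr 2
        funext κ
        by_cases h : κ = μ
        · subst h; simp; ring
        · simp [Function.update_of_ne h]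

/-- The bonds of the backward straight segment `(−e_μ)^n` from `π(z)` are `⟨π(z − (i+1) e_μ), μ⟩`, `i < n`. [folklore] -/
theorem mem_walk_replicate_false (μ : Fin P.d) :
    ∀ (n : ℕ) (z : Pt P.d), ∀ st ∈ walk (cover P z) (List.replicate n (μ, false)),
      ∃ i : ℕ, i < n ∧ st.bond = ⟨cover P (Function.update z μ (z μ - (i + 1))), μ⟩
  | 0, z, st, hst => by simp [walk] at hst
  | n + 1, z, st, hst => by
      rw [List.replicate_succ] at hst
      change st ∈ (⟨⟨(cover P z).unshift μ, μ⟩, false⟩ :: walk ((cover P z).unshift μ) (List.replicate n (μ, false))) at hst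
      rw [unshift_cover] at hst
      rcases List.mem_cons.1 hst with rfl | hst'
      · exact ⟨0, Nat.succ_pos _, by simp⟩
      · obtain ⟨i, hi, hb⟩ := mem_walk_replicate_false μ n _ st hst'
        refine ⟨i + 1, by omega, ?_⟩
        rw [hb]
        congr 2
        funext κ
        by_cases h : κ = μ
        · subst h; simp; ring
        · simp [Function.update_of_ne h]

end Walks

/-! ## §2  The uniform-flux abelian configuration: plaquettes and the vanishing Yang–Mills current -/
section Flux

variable {P : Params} {N : ℕ} [NeZero N]

/-- Seam bookkeeping: `D^{(a+1).val} = D^{a.val}·D` for `a ∈ ℤ_P` when `D^P = 1`. [folklore] -/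
theorem pow_val_add_one {M : Type*} [Monoid M] {D : M} (hDP : D ^ P.sitesPerDir 0 = 1) (a : ZMod (P.sitesPerDir 0)) :
    D ^ (a + 1).val = D ^ a.val * D := by
  rw [ZMod.val_add, ← pow_eq_pow_mod _ hDP, pow_add, ZMod.val_one_eq_one_mod, ← pow_eq_pow_mod _ hDP, pow_one]

variable {μ₁ μ₂ : Fin P.d} {D : SU N} {U : GaugeField P 0 (SU N)}

/-- **★ THE PLAQUETTES OF THE UNIFORM-FLUX CONFIGURATION**: `U(∂p) = D` on the `μ₁μ₂`-plaquettes, `1` on all others. [cite: Balaban1985Averaging, (9) p.19 (bookkeeping: plaquette variables)] -/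
theorem plaqHol_flux (h12 : μ₁ < μ₂) (hDP : D ^ P.sitesPerDir 0 = 1) (hU : ∀ b, U b = if b.dir = μ₂ then D ^ (b.src μ₁).val else 1)
    (p : Plaq P 0) : GaugeField.plaqHol U p = if p.μ = μ₁ ∧ p.ν = μ₂ then D else 1 := by
  have hne12 : μ₁ ≠ μ₂ := ne_of_lt h12
  unfold GaugeField.plaqHol
  rw [hU, hU, hU, hU]
  dsimp only
  -- the `μ₁`-coordinates of the shifted corners
  have hsμ : ∀ μ : Fin P.d, μ ≠ μ₁ → (p.src.shift μ) μ₁ = p.src μ₁ := fun μ hμ => by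
    rw [Site.shift_apply, if_neg (Ne.symm hμ)]
  have hs1 : (p.src.shift μ₁) μ₁ = p.src μ₁ + 1 := by rw [Site.shift_apply, if_pos rfl]
  by_cases hν : p.ν = μ₂
  · have hμ2 : p.μ ≠ μ₂ := fun h => absurd (h.trans hν.symm) (ne_of_lt p.hμν)
    by_cases hμ : p.μ = μ₁
    · -- the flux plaquette
      have hc : p.μ = μ₁ ∧ p.ν = μ₂ := ⟨hμ, hν⟩
      simp only [if_neg hμ2, if_pos hν, if_pos hc]
      rw [hμ, hs1, pow_val_add_one hDP, pow_mul_comm']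
      simp
    · have hc : ¬ (p.μ = μ₁ ∧ p.ν = μ₂) := fun h => hμ h.1
      simp only [if_neg hμ2, if_pos hν, if_neg hc]
      rw [hsμ _ hμ]
      simp
  · have hc : ¬ (p.μ = μ₁ ∧ p.ν = μ₂) := fun h => hν h.2
    by_cases hμ : p.μ = μ₂
    · have hν1 : p.ν ≠ μ₁ := fun h => absurd (hμ ▸ h ▸ p.hμν) (not_lt.mpr h12.le)
      simp only [if_pos hμ, if_neg hν, if_neg hc]
      rw [hsμ _ hν1]
      simp
    · simp only [if_neg hμ, if_neg hν, if_neg hc]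
      simp

/-- Every plaquette of the uniform-flux configuration is within `dist1 D` of `1`. [cite: Balaban1985Variational, (2) p.278 (bookkeeping)] -/
theorem dist1_plaqHol_flux_le (h12 : μ₁ < μ₂) (hDP : D ^ P.sitesPerDir 0 = 1) (hU : ∀ b, U b = if b.dir = μ₂ then D ^ (b.src μ₁).val else 1)
    (p : Plaq P 0) : dist1 (GaugeField.plaqHol U p) ≤ dist1 D := by
  rw [plaqHol_flux h12 hDP hU]
  split_ifs
  · exact le_rfl
  · rw [GaugeGroup.dist1_one]; exact GaugeGroup.dist1_nonneg _

omit [NeZero N] in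
/-- Every bond variable of the uniform-flux configuration commutes with `D` (all are powers of `D`). [folklore] -/
theorem commute_flux (hU : ∀ b, U b = if b.dir = μ₂ then D ^ (b.src μ₁).val else 1) (b : PBond P 0) (g : SU N) (hg : g = D ∨ g = 1) :
    U b * g = g * U b := by
  rw [hU]
  rcases hg with rfl | rfl
  · split_ifs
    · exact (Commute.pow_self g _).eq
    · simp
  · simp

/-- **★ THE YANG–MILLS CURRENT OF THE UNIFORM-FLUX CONFIGURATION VANISHES**: `Sect2.coDivSum U x μ = 0` at every bond ([6] (1.2): each term is `R(U(x,x−e_ν))F(x−e_ν) − F(x)`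
with `F` translation invariant and commuting with the bond variables). [cite: Balaban1985RegularSpaces, (1.1)–(1.2) p.76, (1.9) p.77] -/
theorem coDivSum_flux (h12 : μ₁ < μ₂) (hDP : D ^ P.sitesPerDir 0 = 1) (hU : ∀ b, U b = if b.dir = μ₂ then D ^ (b.src μ₁).val else 1)
    (x : Site P 0) (μ : Fin P.d) : Sect2.coDivSum U x μ = 0 := by
  have hterm : ∀ (y : Site P 0) (ν α β : Fin P.d) (h : α < β), Sect2.coDivTerm U y ν α β h = 0 := by
    intro y ν α β h
    unfold Sect2.coDivTerm Sect2.plaqMat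
    rw [plaqHol_flux h12 hDP hU, plaqHol_flux h12 hDP hU]
    dsimp only
    set g : SU N := if α = μ₁ ∧ β = μ₂ then D else 1 with hg
    have hg' : g = D ∨ g = 1 := by rw [hg]; split_ifs <;> simp
    have hcomm : (U ⟨y.unshift ν, ν⟩)⁻¹ * g * U ⟨y.unshift ν, ν⟩ = g := by
      rw [mul_assoc, ← commute_flux hU _ g hg', ← mul_assoc, inv_mul_cancel, one_mul]
    have hmat : ((ιSU N (U ⟨y.unshift ν, ν⟩)⁻¹ : (MatA N)ˣ) : MatA N) * ((ιSU N g : (MatA N)ˣ) : MatA N) * ((ιSU N (U ⟨y.unshift ν, ν⟩) : (MatA N)ˣ) : MatA N) =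
        ((ιSU N g : (MatA N)ˣ) : MatA N) := by
      rw [← Units.val_mul, ← Units.val_mul, ← map_mul, ← map_mul, hcomm]
    rw [hmat, sub_self]
  unfold Sect2.coDivSum
  refine Finset.sum_eq_zero fun ν _ => ?_
  split_ifs
  · exact hterm _ _ _ _ _
  · rw [hterm, neg_zero]
  · rfl

/-- Hence (1.9) holds for the uniform-flux configuration on every bond set at every positive threshold. [cite: Balaban1985RegularSpaces, (1.9) p.77] -/
theorem coDivSmallOn_flux (h12 : μ₁ < μ₂) (hDP : D ^ P.sitesPerDir 0 = 1) (hU : ∀ b, U b = if b.dir = μ₂ then D ^ (b.src μ₁).val else 1)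
    (S : Set (PBond P 0)) {δ : ℝ} (hδ : 0 < δ) : Sect2.CoDivSmallOn S δ U := fun b _ => by
  rw [coDivSum_flux h12 hDP hU, norm_zero]; exact hδ

/-! ### straight transports and the square -/

/-- Along `(±e_{μ₁})^n` the transport is `1` (every `μ₁`-bond variable is `1`). [folklore] -/
theorem holAt_flux_replicate_dir₁ (h12 : μ₁ < μ₂) (hU : ∀ b, U b = if b.dir = μ₂ then D ^ (b.src μ₁).val else 1) (b : Bool) :
    ∀ (n : ℕ) (x : Site P 0), holAt U (walk x (List.replicate n (μ₁, b))) = 1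
  | 0, x => by simp [walk, holAt_nil]
  | n + 1, x => by
      have hne : μ₁ ≠ μ₂ := ne_of_lt h12
      rw [List.replicate_succ]
      cases b
      · change holAt U (⟨⟨x.unshift μ₁, μ₁⟩, false⟩ :: walk (x.unshift μ₁) (List.replicate n (μ₁, false))) = 1
        rw [holAt_cons, holAt_flux_replicate_dir₁ h12 hU false n, hU]
        simp [hne]
      · change holAt U (⟨⟨x, μ₁⟩, true⟩ :: walk (x.shift μ₁) (List.replicate n (μ₁, true))) = 1
        rw [holAt_cons, holAt_flux_replicate_dir₁ h12 hU true n, hU]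
        simp [hne]

/-- Along `(+e_{μ₂})^n` from `x` the transport is `D^{n·x_{μ₁}}` (the `μ₁`-coordinate does not move). [folklore] -/
theorem holAt_flux_replicate_fwd₂ (h12 : μ₁ < μ₂) (hU : ∀ b, U b = if b.dir = μ₂ then D ^ (b.src μ₁).val else 1) :
    ∀ (n : ℕ) (x : Site P 0), holAt U (walk x (List.replicate n (μ₂, true))) = D ^ (n * (x μ₁).val)
  | 0, x => by simp [walk, holAt_nil]
  | n + 1, x => by
      have hne : μ₁ ≠ μ₂ := ne_of_lt h12
      rw [List.replicate_succ]
      change holAt U (⟨⟨x, μ₂⟩, true⟩ :: walk (x.shift μ₂) (List.replicate n (μ₂, true))) = _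
      rw [holAt_cons, holAt_flux_replicate_fwd₂ h12 hU n, hU, Site.shift_apply, if_neg hne]
      simp only [if_true]
      rw [← pow_add]; congr 1; ring

/-- Along `(−e_{μ₂})^n` from `x` the transport is `(D^{n·x_{μ₁}})⁻¹`. [folklore] -/
theorem holAt_flux_replicate_bwd₂ (h12 : μ₁ < μ₂) (hU : ∀ b, U b = if b.dir = μ₂ then D ^ (b.src μ₁).val else 1) :
    ∀ (n : ℕ) (x : Site P 0), holAt U (walk x (List.replicate n (μ₂, false))) = (D ^ (n * (x μ₁).val))⁻¹
  | 0, x => by simp [walk, holAt_nil]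
  | n + 1, x => by
      have hne : μ₁ ≠ μ₂ := ne_of_lt h12
      have hux : (x.unshift μ₂) μ₁ = x μ₁ := by rw [Site.unshift, Function.update_of_ne hne]
      rw [List.replicate_succ]
      change holAt U (⟨⟨x.unshift μ₂, μ₂⟩, false⟩ :: walk (x.unshift μ₂) (List.replicate n (μ₂, false))) = _
      rw [holAt_cons, holAt_flux_replicate_bwd₂ h12 hU n, hux, hU]
      dsimp only
      rw [hux]
      simp only [if_true, Bool.false_eq_true, if_false]
      rw [← mul_inv_rev, ← pow_add]; congr 2; ring

/-- **★ ABELIAN STOKES FOR THE SQUARE**: from a site with `x_{μ₁} = 0`, along the square word `(+e₁)^s(+e₂)^s(−e₁)^s(−e₂)^s` (`T4ReflectionCone.rectWord μ₁ μ₂ s s`) with `s < P`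
(no seam is crossed), the holonomy of the uniform-flux configuration is `D^{s·s}` — the flux through the square. [cite: Balaban1985Averaging, (8)–(9) pp.18–19 (bookkeeping: Stokes on the lattice)] -/
theorem holAt_flux_rectWord (h12 : μ₁ < μ₂) (hU : ∀ b, U b = if b.dir = μ₂ then D ^ (b.src μ₁).val else 1)
    {x : Site P 0} (hx : x μ₁ = 0) {s : ℕ} (hs : s < P.sitesPerDir 0) :
    holAt U (walk x (T4ReflectionCone.rectWord μ₁ μ₂ s s)) = D ^ (s * s) := by
  have hne : μ₁ ≠ μ₂ := ne_of_lt h12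
  unfold T4ReflectionCone.rectWord
  rw [walk_append, holAt_append, walk_append, holAt_append, walk_append, holAt_append]
  rw [holAt_flux_replicate_dir₁ h12 hU true, holAt_flux_replicate_fwd₂ h12 hU, holAt_flux_replicate_dir₁ h12 hU false,
    holAt_flux_replicate_bwd₂ h12 hU]
  -- the `μ₁`-coordinates at the two corners where the `μ₂`-segments start
  have hc1 : (walkEnd x (List.replicate s (μ₁, true)) μ₁).val = s := by
    rw [walkEnd_apply, T4ReflectionCone.netDisp_replicate, hx]
    simp [ZMod.val_natCast, Nat.mod_eq_of_lt hs]
  have hc2 : (walkEnd x (List.replicate s (μ₁, true) ++ List.replicate s (μ₂, true) ++ List.replicate s (μ₁, false)) μ₁).val = 0 := by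
    rw [walkEnd_apply, T4ReflectionCone.netDisp_append, T4ReflectionCone.netDisp_append, T4ReflectionCone.netDisp_replicate,
      T4ReflectionCone.netDisp_replicate, T4ReflectionCone.netDisp_replicate, hx]
    simp [Ne.symm hne]
  rw [hc1, hc2]
  simp

end Flux

end Summit.QuantumFields.YangMills.Theorems.K0UniformFluxConfig

end
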